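import Mathlib
import Literature.NumberTheory.Transcendental.KZCalculus
import Literature.NumberTheory.Transcendental.KZLogCalculusProofs
import Literature.NumberTheory.Transcendental.KZMellinFibres
import Literature.NumberTheory.Transcendental.KZSemialgebraicComplex
import Literature.NumberTheory.Transcendental.SemialgebraicMapsProofs
import Literature.NumberTheory.Transcendental.EllIterRep
import Summits.KontsevichZagierPeriods.KontsevichZagierPeriods.Theorems.HermiteRigidityCMTwistQuasiPeriodTransferMoves
import Summits.KontsevichZagierPeriods.KontsevichZagierPeriods.Theses.TorsionLogs

/-!
# Route TorsionLogs — support item `GKZLevelThreePair`: Euler's reflection at `1/3`, I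
# (`B(2/3,1/3) = ∫₀¹ s^{-1/3}(1-s)^{-2/3} ds` made rational by ONE change of variables)

Helper file for item `stmt-KontsevichZagierPeriods-13812` (`GKZLevelThreePair`), step (S6) of the
prover's blueprint (item evidence `blueprint-13812.md`): the Beta factor
`Brep = [(0,1), s^{-1/3}(1-s)^{-2/3}]` of the level-3 Euler representation (value
`B(2/3,1/3) = Γ(2/3)Γ(1/3) = 2π/√3`, Euler's reflection formula at `1/3`) is made RATIONAL inside
the Kontsevich–Zagier calculus of moves:

* `cubicRational_equivalent_beta` — ONE change of variables (rule 2)),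
  `s = φ(w) = w³/(w³ + (1-w)³) = w³/(3w²-3w+1)` from `(0,1)` onto `(0,1)` (strictly increasing,
  `φ(0) = 0`, `φ(1) = 1`): `1 - φ(w) = (1-w)³/(3w²-3w+1)`, `φ'(w) = 3w²(1-w)²/(3w²-3w+1)²`, and the
  pull-back identity `φ^{-1/3}(1-φ)^{-2/3}φ' = 3w/(3w²-3w+1)` (`cubicSubst_pullback`):
  `[(0,1), 3w/(3w²-3w+1)] ∼ Brep`;
* generic one-dimensional bookkeeping (`exists_rep_Ioo₁`: bounded representations on bounded
  intervals with algebraic endpoints exist; `isSemialgebraicFunOn_ratFun₁`).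

All representations are PINNED by their domain and their integrand on it. Continued in
`TorsionLogsGKZLevelThreePairBetaArctan.lean` (symmetrisation and the affine substitution to the
arctangent arc `[(0,√3), 2√3/(1+x²)]`).

## References

* M. Kontsevich, D. Zagier, *Periods* (2001), §1.2 rule (2).
* G. Andrews, R. Askey, R. Roy, *Special Functions* (1999), Thm. 1.2.1 (Euler's reflection formula).
-/

-- `Summit.<Summit>.<Sub>` with Sub = Summit (single-conjunct summit, D-0017) duplicates the segment.
set_option linter.dupNamespace false

noncomputable section

namespace Summit.KontsevichZagierPeriods.KontsevichZagierPeriods.Theorems.GKZLevelThree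

open Set MeasureTheory
open MvPolynomial (aeval X C)
open Literature.NumberTheory.Transcendental Literature.NumberTheory.Transcendental.KZ
open Literature.ModelTheory.ExponentialFields (IsSemialgebraic isSemialgebraic_setOf_eval_pos)
open Summit.KontsevichZagierPeriods.HermiteRigidity.CMTwistQuasiPeriodTransfer
  (isSemialgebraic_setOf_apply_lt_of_isAlgebraic isSemialgebraic_setOf_apply_gt_of_isAlgebraic
    of_sub_of_mem_changeOfVariablesRel_dimOne)

/-! ## Intervals of `ℝ¹` and bounded representations on them -/

/-- **Bounded representations on bounded intervals exist**: if `f` is continuous on `[a, b]`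
(`a < b` real algebraic) and `x ↦ f (x 0)` is `ℚ`-semialgebraic on `{a < x₀ < b}`, there is a
representation with that domain and the integrand `x ↦ f (x 0)` (integrable as a continuous
function on the compact box `[a, b]`). [Kontsevich–Zagier 2001, §1.1] -/
theorem exists_rep_Ioo₁ {a b : ℝ} (ha : IsAlgebraic ℚ a) (hb : IsAlgebraic ℚ b) (f : ℝ → ℝ)
    (hf : ContinuousOn f (Icc a b))
    (hsa : IsSemialgebraicFunOn ℚ {x : Fin 1 → ℝ | a < x 0 ∧ x 0 < b} (fun x => f (x 0))) :
    ∃ r : IntegralRep 1, r.domain = {x : Fin 1 → ℝ | a < x 0 ∧ x 0 < b} ∧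
      r.integrand = fun x => f (x 0) := by
  have hK : IsCompact (Set.pi univ fun _ : Fin 1 => Icc a b) := isCompact_univ_pi fun _ => isCompact_Icc
  have hcont : ContinuousOn (fun x : Fin 1 → ℝ => f (x 0)) (Set.pi univ fun _ : Fin 1 => Icc a b) :=
    hf.comp (continuous_apply 0).continuousOn fun x hx => (mem_univ_pi.mp hx) 0
  have hint : IntegrableOn (fun x : Fin 1 → ℝ => f (x 0)) {x : Fin 1 → ℝ | a < x 0 ∧ x 0 < b} := by
    refine (hcont.integrableOn_compact hK).mono_set fun x hx => ?_
    simp only [mem_univ_pi, mem_Icc]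
    intro i
    rw [Subsingleton.elim i 0]
    exact ⟨hx.1.le, hx.2.le⟩
  exact ⟨⟨_, _, ((KZ.isSemialgebraic_setOf_const_lt_apply ha 0).inter (KZ.isSemialgebraic_setOf_apply_lt_const hb 0)), hsa, hint⟩, rfl, rfl⟩

/-- A rational function `p/q` of `x₀` with `q ≠ 0` on a `ℚ`-semialgebraic set is `ℚ`-semialgebraic
there (repackaging of `isSemialgebraicFunOn_aeval_div_aeval`). -/
theorem isSemialgebraicFunOn_ratFun₁ {s : Set (Fin 1 → ℝ)} (hs : IsSemialgebraic ℚ s)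
    (p q : MvPolynomial (Fin 1) ℚ) (f : ℝ → ℝ)
    (hq : ∀ x ∈ s, aeval x q ≠ 0) (hf : ∀ x ∈ s, f (x 0) = aeval x p / aeval x q) :
    IsSemialgebraicFunOn ℚ s (fun x => f (x 0)) :=
  (isSemialgebraicFunOn_aeval_div_aeval hs p q hq).congr fun x hx => (hf x hx).symm

/-! ## Step 1: `s = w³/(3w²-3w+1)` makes `B(2/3,1/3)` rational -/

/-- The denominator `q(w) = 3w² - 3w + 1 = 3(w - 1/2)² + 1/4` is positive. -/
theorem cubicDen_pos (w : ℝ) : 0 < 3 * w ^ 2 - 3 * w + 1 := by nlinarith [sq_nonneg (w - 1/2)]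

/-- `w³ + (1-w)³ = 3w² - 3w + 1`. -/
theorem cube_add_cube (w : ℝ) : w ^ 3 + (1 - w) ^ 3 = 3 * w ^ 2 - 3 * w + 1 := by ring

/-- The derivative of `φ(w) = w³/(3w²-3w+1)` is `3w²(1-w)²/(3w²-3w+1)²`. -/
theorem hasDerivAt_cubicSubst (w : ℝ) :
    HasDerivAt (fun w : ℝ => w ^ 3 / (3 * w ^ 2 - 3 * w + 1))
      (3 * w ^ 2 * (1 - w) ^ 2 / (3 * w ^ 2 - 3 * w + 1) ^ 2) w := by
  have hq : (3 * w ^ 2 - 3 * w + 1) ≠ 0 := (cubicDen_pos w).ne'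
  have h1 : HasDerivAt (fun w : ℝ => w ^ 3) (3 * w ^ 2) w := by
    simpa using hasDerivAt_pow 3 w
  have h2 : HasDerivAt (fun w : ℝ => 3 * w ^ 2 - 3 * w + 1) (6 * w - 3) w := by
    have h := (((hasDerivAt_pow 2 w).const_mul (3:ℝ)).sub ((hasDerivAt_id' w).const_mul (3:ℝ))).add_const (1:ℝ)
    exact h.congr_deriv (by norm_num; ring)
  exact (h1.div h2 hq).congr_deriv (by ring)

/-- `φ = w³/(3w²-3w+1)` is strictly increasing on `[0,1]`. -/
theorem strictMonoOn_cubicSubst :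
    StrictMonoOn (fun w : ℝ => w ^ 3 / (3 * w ^ 2 - 3 * w + 1)) (Icc 0 1) := by
  refine strictMonoOn_of_deriv_pos (convex_Icc 0 1) ?_ fun w hw => ?_
  · exact (continuousOn_id.pow 3).div (by fun_prop) fun w _ => (cubicDen_pos w).ne'
  · rw [interior_Icc] at hw
    rw [(hasDerivAt_cubicSubst w).deriv]
    have h1 : 0 < w := hw.1
    have h2 : 0 < 1 - w := by linarith [hw.2]
    have h3 := cubicDen_pos w
    positivity

/-- `φ` maps `(0,1)` onto `(0,1)` (`φ(0) = 0`, `φ(1) = 1`, intermediate values). -/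
theorem image_cubicSubst :
    (fun w : ℝ => w ^ 3 / (3 * w ^ 2 - 3 * w + 1)) '' Ioo 0 1 = Ioo 0 1 := by
  set φ : ℝ → ℝ := fun w => w ^ 3 / (3 * w ^ 2 - 3 * w + 1) with hφ
  have hφ0 : φ 0 = 0 := by simp [hφ]
  have hφ1 : φ 1 = 1 := by norm_num [hφ]
  have hcont : ContinuousOn φ (Icc 0 1) :=
    (continuousOn_id.pow 3).div (by fun_prop) fun w _ => (cubicDen_pos w).ne'
  apply Subset.antisymm
  · rintro _ ⟨w, hw, rfl⟩
    have hm := strictMonoOn_cubicSubst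
    refine ⟨?_, ?_⟩
    · simpa [hφ0] using hm (left_mem_Icc.2 zero_le_one) (Ioo_subset_Icc_self hw) hw.1
    · simpa [hφ1] using hm (Ioo_subset_Icc_self hw) (right_mem_Icc.2 zero_le_one) hw.2
  · intro y hy
    obtain ⟨w, hw, hwy⟩ : y ∈ φ '' Icc 0 1 := by
      have := intermediate_value_Icc zero_le_one hcont
      rw [hφ0, hφ1] at this
      exact this (Ioo_subset_Icc_self hy)
    refine ⟨w, ⟨?_, ?_⟩, hwy⟩
    · rcases hw.1.lt_or_eq with h | h
      · exact h
      · exfalso; rw [← h, hφ0] at hwy; linarith [hy.1]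
    · rcases hw.2.lt_or_eq with h | h
      · exact h
      · exfalso; rw [h, hφ1] at hwy; linarith [hy.2]

/-- The pull-back identity of Step 1: for `0 < w < 1` and `s = w³/q`, `q = 3w²-3w+1`,
`s^{-1/3} (1-s)^{-2/3} · (3w²(1-w)²/q²) = 3w/q`. -/
theorem cubicSubst_pullback {w : ℝ} (hw : w ∈ Ioo (0:ℝ) 1) :
    (w ^ 3 / (3 * w ^ 2 - 3 * w + 1)) ^ (-(1:ℝ) / 3) *
        (1 - w ^ 3 / (3 * w ^ 2 - 3 * w + 1)) ^ (-(2:ℝ) / 3) *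
        (3 * w ^ 2 * (1 - w) ^ 2 / (3 * w ^ 2 - 3 * w + 1) ^ 2) =
      3 * w / (3 * w ^ 2 - 3 * w + 1) := by
  set q : ℝ := 3 * w ^ 2 - 3 * w + 1 with hq
  have hq0 : 0 < q := cubicDen_pos w
  have hw0 : 0 < w := hw.1
  have hw1 : 0 < 1 - w := by linarith [hw.2]
  have h3 : (3:ℕ) ≠ 0 := by norm_num
  -- `(w³/q)^{-1/3} = q^{1/3}/w`
  have hA : (w ^ 3 / q) ^ (-(1:ℝ) / 3) = q ^ ((3:ℕ)⁻¹ : ℝ) / w := by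
    rw [show (-(1:ℝ) / 3) = -((3:ℕ)⁻¹ : ℝ) by norm_num, Real.rpow_neg (by positivity),
      Real.div_rpow (by positivity) hq0.le, Real.pow_rpow_inv_natCast hw0.le h3, inv_div]
  -- `(1 - w³/q)^{-2/3} = q^{2/3}/(1-w)²`
  have h1s : 1 - w ^ 3 / q = (1 - w) ^ 3 / q := by
    field_simp
    rw [hq]; ring
  have hB : (1 - w ^ 3 / q) ^ (-(2:ℝ) / 3) = (q ^ ((3:ℕ)⁻¹ : ℝ)) ^ 2 / (1 - w) ^ 2 := by
    rw [h1s, show (-(2:ℝ) / 3) = -(((3:ℕ)⁻¹ : ℝ) * 2) by norm_num, Real.rpow_neg (by positivity),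
      Real.div_rpow (by positivity) hq0.le, Real.rpow_mul (by positivity), Real.rpow_mul hq0.le,
      Real.pow_rpow_inv_natCast hw1.le h3, inv_div]
    norm_num [Real.rpow_two]
  -- `c = q^{1/3}`, `c³ = q`
  set c : ℝ := q ^ ((3:ℕ)⁻¹ : ℝ) with hc
  have hc3 : c ^ 3 = q := Real.rpow_inv_natCast_pow hq0.le h3
  have hc0 : c ≠ 0 := by
    intro h0
    rw [h0] at hc3
    norm_num at hc3
    exact hq0.ne' hc3.symm
  rw [hA, hB, ← hc3]
  have hw0' : w ≠ 0 := hw0.ne'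
  have hw1' : (1 - w) ≠ 0 := hw1.ne'
  field_simp

/-- **Step 1.** `[(0,1), 3w/(3w²-3w+1)] ∼ [(0,1), s^{-1/3}(1-s)^{-2/3}]` by ONE change of variables
`s = w³/(3w²-3w+1)` (rule 2)): `ℚ`-rational, strictly increasing from `(0,1)` onto `(0,1)`, with the
pull-back identity `cubicSubst_pullback`. [Kontsevich–Zagier 2001, §1.2 rule (2)] -/
theorem cubicRational_equivalent_beta (W β : IntegralRep 1)
    (hWd : W.domain = {x | x 0 ∈ Set.Ioo (0:ℝ) 1})
    (hWi : EqOn W.integrand (fun x => 3 * x 0 / (3 * x 0 ^ 2 - 3 * x 0 + 1)) W.domain)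
    (hβd : β.domain = {x | x 0 ∈ Set.Ioo (0:ℝ) 1})
    (hβi : EqOn β.integrand (fun x => (x 0) ^ (-(1:ℝ) / 3) * (1 - x 0) ^ (-(2:ℝ) / 3)) β.domain) :
    Equivalent W β := by
  set φ : ℝ → ℝ := fun w => w ^ 3 / (3 * w ^ 2 - 3 * w + 1) with hφ
  set φ' : ℝ → ℝ := fun w => 3 * w ^ 2 * (1 - w) ^ 2 / (3 * w ^ 2 - 3 * w + 1) ^ 2 with hφ'
  refine changeOfVariablesRel_subset_relations
    (of_sub_of_mem_changeOfVariablesRel_dimOne W β φ φ' ?_ (fun p _ => hasDerivAt_cubicSubst (p 0))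
      ?_ ?_ ?_)
  · refine isSemialgebraicFunOn_ratFun₁ W.isSemialgebraic_domain (X 0 ^ 3)
      (C 3 * X 0 ^ 2 - C 3 * X 0 + 1) φ (fun x _ => ?_) (fun x _ => ?_)
    · simp only [map_add, map_sub, map_mul, map_pow, MvPolynomial.aeval_C, MvPolynomial.aeval_X,
        map_one, eq_ratCast, Rat.cast_ofNat]
      exact (cubicDen_pos (x 0)).ne'
    · simp [hφ]
  · intro p hp q hq h
    rw [hWd] at hp hq
    exact (strictMonoOn_cubicSubst.injOn (Ioo_subset_Icc_self hp) (Ioo_subset_Icc_self hq) h)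
  · rw [hβd, hWd]
    ext y
    simp only [mem_setOf_eq, mem_image]
    constructor
    · intro hy
      have : y 0 ∈ φ '' Ioo 0 1 := by rw [image_cubicSubst]; exact hy
      obtain ⟨w, hw, hwy⟩ := this
      exact ⟨fun _ => w, hw, funext fun i => by rw [Subsingleton.elim i 0]; exact hwy⟩
    · rintro ⟨p, hp, rfl⟩
      have : φ (p 0) ∈ φ '' Ioo 0 1 := mem_image_of_mem φ hp
      rwa [image_cubicSubst] at this
  · intro p hp
    have hp' : p 0 ∈ Ioo (0:ℝ) 1 := by rw [hWd] at hp; exact hp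
    have hφp : (fun _ : Fin 1 => φ (p 0)) ∈ β.domain := by
      rw [hβd]
      show φ (p 0) ∈ Ioo (0:ℝ) 1
      rw [← image_cubicSubst]
      exact mem_image_of_mem φ hp'
    have hpos : 0 < φ' (p 0) := by
      have h1 : 0 < p 0 := hp'.1
      have h2 : 0 < 1 - p 0 := by linarith [hp'.2]
      have h3 := cubicDen_pos (p 0)
      simp only [hφ']
      positivity
    rw [hWi hp, hβi hφp, abs_of_pos hpos]
    exact (cubicSubst_pullback hp').symm

/-- `[(0,1), 3w/(3w²-3w+1)]` exists. -/
theorem exists_cubicRationalRep : ∃ W : IntegralRep 1, W.domain = {x | x 0 ∈ Set.Ioo (0:ℝ) 1} ∧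
    W.integrand = fun x => 3 * x 0 / (3 * x 0 ^ 2 - 3 * x 0 + 1) := by
  obtain ⟨W, hWd, hWi⟩ := exists_rep_Ioo₁ isAlgebraic_zero isAlgebraic_one
    (fun w => 3 * w / (3 * w ^ 2 - 3 * w + 1))
    ((by fun_prop : Continuous fun w : ℝ => 3 * w).continuousOn.div (by fun_prop)
      fun w _ => (cubicDen_pos w).ne') (by
    refine isSemialgebraicFunOn_ratFun₁ (((KZ.isSemialgebraic_setOf_const_lt_apply isAlgebraic_zero 0).inter (KZ.isSemialgebraic_setOf_apply_lt_const isAlgebraic_one 0)))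
      (C 3 * X 0) (C 3 * X 0 ^ 2 - C 3 * X 0 + 1) (fun w => 3 * w / (3 * w ^ 2 - 3 * w + 1))
      (fun x _ => ?_) (fun x _ => ?_)
    · simp only [map_add, map_sub, map_mul, map_pow, MvPolynomial.aeval_C, MvPolynomial.aeval_X,
        map_one, eq_ratCast, Rat.cast_ofNat]
      exact (cubicDen_pos (x 0)).ne'
    · simp)
  refine ⟨W, ?_, hWi⟩
  rw [hWd]
  ext x
  simp [mem_Ioo]


end Summit.KontsevichZagierPeriods.KontsevichZagierPeriods.Theorems.GKZLevelThree

end
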